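import Summits.RiemannHypothesis.RiemannHypothesis.Theses.NbGhostOfThePole
import Summits.RiemannHypothesis.RiemannHypothesis.Theorems.NbSectionTwoDyadicPairing
import HarnessLib

/-!
# Route NbGhostOfThePole — crux `TrivialGainLaw` (stmt-RiemannHypothesis-22976)

THE ONE-TERM LAW (the «tighten» side of the ghost of the pole, exact): for every `M ≥ 1` the
constant mollifier `a = H_M/(2M − H_M)`, `H_M = Σ_{n ≤ M} 1/n`, gives EXACTLY

  `∫ |1 − a ζ_M(1/2+it)|² dt/(1/4+t²) = 2π (1 − H_M²/(2M − H_M))`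

(as an `ENNReal.ofReal` identity for the Báez-Duarte lintegral with a length-one Dirichlet
polynomial `A(s) = a·1^{-s}`).  Proof: write `1 − a ζ_M(s) = Σ_{m ≤ M} c_m m^{-s}` with
`c = e₁ − a` and apply the NB-GRAM EXPANSION of the sibling toolkit
`Theorems/NbSectionTwoDyadicPairing.lean` (`NbSectionTwo.integral_norm_sq_sum_cpow_div`:
`∫ ‖Σ c_m m^{-(1/2+it)}‖²/(1/4+t²) = Σ_{m,n} Re(c_m c̄_n)·2π/max(m,n)`, pairing kernel
`2π/max(m,n)` of the critical-line measure); the Gram sums are `⟨e₁,e₁⟩ = 1`, `⟨e₁,𝟙⟩ = H_M`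
and `G_M := Σ_{m,n ≤ M} 1/max(m,n) = Σ_k (2k−1)/k = 2M − H_M` (`sum_sum_one_div_max`), so the
value is `2π(1 − 2aH_M + a² G_M) = 2π(1 − H_M²/G_M)` at `a = H_M/G_M` (the minimum over constant
mollifiers; only the identity is filed).  `lintegral = ofReal ∫` by integrability
(`NbSectionTwo.integrable_norm_sq_sum_cpow_div`).

Contents: §1 the finite Gram sums; §2 the coefficient rewrite and the Gram value; §3 the closer
`TrivialGainLaw_proof : …Theses.NbGhostOfThePole.TrivialGainLaw` (by name).

RH-free, no definitions, standard axioms.  References: L. Báez-Duarte, Rend. Lincei 14 (2003) 5–11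
(the Dirichlet-polynomial distance); J.-F. Burnol, Adv. Math. 170 (2002); A. Beurling, Proc. Nat.
Acad. Sci. 41 (1955).  No summit is proved by this file; nothing here bears on the truth of RH.
-/

noncomputable section

-- D-0017: `Summit.<S>.<S>.…` is the designed namespace of a single-problem summit.
set_option linter.dupNamespace false

open scoped Real ComplexConjugate
open MeasureTheory Complex Finset

namespace Summit.RiemannHypothesis.RiemannHypothesis.Theorems.NbGhostOfThePole

open Literature.Barriers.RiemannHypothesis
open Summit.RiemannHypothesis.RiemannHypothesis.Theorems.NbSectionTwo

/-! ## §1 — The finite Gram sums of the pairing kernel `1/max(m,n)` -/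

/-- `Σ_{m ≤ M} 1/max(m, M+1) = M/(M+1)`. [folklore] -/
theorem sum_Icc_one_div_max_succ (M : ℕ) :
    ∑ m ∈ Finset.Icc 1 M, (1 : ℝ) / ((max m (M + 1) : ℕ) : ℝ) = (M : ℝ) / ((M : ℝ) + 1) := by
  have h : ∀ m ∈ Finset.Icc 1 M, (1 : ℝ) / ((max m (M + 1) : ℕ) : ℝ) = 1 / ((M : ℝ) + 1) := by
    intro m hm
    rw [Finset.mem_Icc] at hm
    rw [max_eq_right (by omega)]
    push_cast
    rfl
  rw [Finset.sum_congr rfl h, Finset.sum_const, Nat.card_Icc, nsmul_eq_mul]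
  have : (M + 1 - 1 : ℕ) = M := by omega
  rw [this]
  field_simp

/-- `Σ_{n ≤ M} 1/max(M+1, n) = M/(M+1)`. [folklore] -/
theorem sum_Icc_one_div_max_succ' (M : ℕ) :
    ∑ n ∈ Finset.Icc 1 M, (1 : ℝ) / ((max (M + 1) n : ℕ) : ℝ) = (M : ℝ) / ((M : ℝ) + 1) := by
  simp_rw [max_comm (M + 1)]
  exact sum_Icc_one_div_max_succ M

/-- **The Gram mass** `G_M = Σ_{m,n ≤ M} 1/max(m,n) = 2M − H_M` (`#{(m,n) : max = k} = 2k − 1`).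
[folklore] -/
theorem sum_sum_one_div_max (M : ℕ) :
    ∑ m ∈ Finset.Icc 1 M, ∑ n ∈ Finset.Icc 1 M, (1 : ℝ) / ((max m n : ℕ) : ℝ) =
      2 * (M : ℝ) - ∑ n ∈ Finset.Icc 1 M, (1 : ℝ) / n := by
  induction M with
  | zero => simp
  | succ M ih =>
    rw [Finset.sum_Icc_succ_top (by omega), Finset.sum_Icc_succ_top (by omega)]
    have hinner : ∀ m ∈ Finset.Icc 1 M,
        ∑ n ∈ Finset.Icc 1 (M + 1), (1 : ℝ) / ((max m n : ℕ) : ℝ) =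
          ∑ n ∈ Finset.Icc 1 M, (1 : ℝ) / ((max m n : ℕ) : ℝ) + 1 / ((max m (M + 1) : ℕ) : ℝ) :=
      fun m _ ↦ Finset.sum_Icc_succ_top (by omega) _
    rw [Finset.sum_congr rfl hinner, Finset.sum_add_distrib, ih, sum_Icc_one_div_max_succ,
      Finset.sum_Icc_succ_top (by omega), sum_Icc_one_div_max_succ', max_self]
    push_cast
    field_simp
    ring

/-! ## §2 — The coefficient vector `c = e₁ − a` and its Gram value -/

/-- **Gram value of `e₁ − a·𝟙`.** For `M ≥ 1` and real `a`:
`Σ_{m,n ≤ M} (e₁−a)_m (e₁−a)_n · 2π/max(m,n) = 2π (1 − 2a H_M + a²(2M − H_M))`. [folklore] -/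
theorem gram_value_e_one_sub_const {M : ℕ} (hM : 1 ≤ M) (a : ℝ) :
    ∑ m ∈ Finset.Icc 1 M, ∑ n ∈ Finset.Icc 1 M,
        (((if m = 1 then (1 : ℝ) else 0) - a) * ((if n = 1 then (1 : ℝ) else 0) - a)) *
          (2 * π / ((max m n : ℕ) : ℝ)) =
      2 * π * (1 - 2 * a * (∑ n ∈ Finset.Icc 1 M, (1 : ℝ) / n) +
        a ^ 2 * (2 * (M : ℝ) - ∑ n ∈ Finset.Icc 1 M, (1 : ℝ) / n)) := by
  set S := Finset.Icc 1 M with hS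
  set H : ℝ := ∑ n ∈ S, (1 : ℝ) / n with hH
  have h1S : (1 : ℕ) ∈ S := by rw [hS, Finset.mem_Icc]; omega
  -- expand the summand into four pieces
  have hexp : ∀ m n : ℕ,
      (((if m = 1 then (1 : ℝ) else 0) - a) * ((if n = 1 then (1 : ℝ) else 0) - a)) *
          (2 * π / ((max m n : ℕ) : ℝ)) =
        (if m = 1 then (if n = 1 then 2 * π / ((max m n : ℕ) : ℝ) else 0) else 0)
          - a * (if m = 1 then 2 * π / ((max m n : ℕ) : ℝ) else 0)
          - a * (if n = 1 then 2 * π / ((max m n : ℕ) : ℝ) else 0)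
          + a ^ 2 * (2 * π / ((max m n : ℕ) : ℝ)) := by
    intro m n
    split_ifs <;> ring
  simp_rw [hexp, Finset.sum_add_distrib, Finset.sum_sub_distrib, ← Finset.mul_sum]
  -- piece 1: `⟨e₁, e₁⟩ = 2π`
  have hp1 : ∑ m ∈ S, ∑ n ∈ S,
      (if m = 1 then (if n = 1 then 2 * π / ((max m n : ℕ) : ℝ) else 0) else 0) = 2 * π := by
    rw [Finset.sum_comm]
    simp_rw [Finset.sum_ite_eq' S 1, if_pos h1S]
    simp [h1S]
  -- piece 2: `⟨e₁, 𝟙⟩ = 2π H`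
  have hp2 : ∑ m ∈ S, ∑ n ∈ S, (if m = 1 then 2 * π / ((max m n : ℕ) : ℝ) else 0) =
      2 * π * H := by
    rw [Finset.sum_comm]
    simp_rw [Finset.sum_ite_eq' S 1, if_pos h1S]
    rw [hH, Finset.mul_sum]
    refine Finset.sum_congr rfl fun n hn ↦ ?_
    rw [hS, Finset.mem_Icc] at hn
    rw [max_eq_right hn.1]
    ring
  -- piece 3: `⟨𝟙, e₁⟩ = 2π H`
  have hp3 : ∑ m ∈ S, ∑ n ∈ S, (if n = 1 then 2 * π / ((max m n : ℕ) : ℝ) else 0) =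
      2 * π * H := by
    simp_rw [Finset.sum_ite_eq' S 1, if_pos h1S]
    rw [hH, Finset.mul_sum]
    refine Finset.sum_congr rfl fun m hm ↦ ?_
    rw [hS, Finset.mem_Icc] at hm
    rw [max_eq_left hm.1]
    ring
  -- piece 4: `⟨𝟙, 𝟙⟩ = 2π (2M − H)`
  have hp4 : ∑ m ∈ S, ∑ n ∈ S, (2 * π / ((max m n : ℕ) : ℝ)) = 2 * π * (2 * (M : ℝ) - H) := by
    have h := sum_sum_one_div_max M
    rw [← hS, ← hH] at h
    rw [← h, Finset.mul_sum]
    refine Finset.sum_congr rfl fun m _ ↦ ?_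
    rw [Finset.mul_sum]
    refine Finset.sum_congr rfl fun n _ ↦ ?_
    ring
  rw [hp1, hp2, hp3, hp4]
  ring

/-- **Coefficient rewrite.** For `M ≥ 1`: `1 − ζ_M(s)·(a·1^{-s}) = Σ_{m ≤ M} (e₁ − a)_m m^{-s}`
(the length-one Dirichlet polynomial `Σ_{n : Fin 1} a (n+1)^{-s} = a`). [folklore] -/
theorem one_sub_zetaPartialSum_mul_const {M : ℕ} (hM : 1 ≤ M) (a : ℝ) (s : ℂ) :
    1 - zetaPartialSum M s * ∑ n : Fin 1, (fun _ : Fin 1 ↦ ((a : ℝ) : ℂ)) n * ((n : ℂ) + 1) ^ (-s) =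
      ∑ m ∈ Finset.Icc 1 M, ((((if m = 1 then (1 : ℝ) else 0) - a : ℝ) : ℂ)) * (m : ℂ) ^ (-s) := by
  have h1S : (1 : ℕ) ∈ Finset.Icc 1 M := by rw [Finset.mem_Icc]; omega
  have hA : ∑ n : Fin 1, (fun _ : Fin 1 ↦ ((a : ℝ) : ℂ)) n * ((n : ℂ) + 1) ^ (-s) = (a : ℂ) := by
    rw [Fin.sum_univ_one]
    simp
  rw [hA, zetaPartialSum]
  have hsplit : ∀ m : ℕ, ((((if m = 1 then (1 : ℝ) else 0) - a : ℝ) : ℂ)) * (m : ℂ) ^ (-s) =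
      (if m = 1 then (m : ℂ) ^ (-s) else 0) - (a : ℂ) * (m : ℂ) ^ (-s) := by
    intro m
    split_ifs <;> push_cast <;> ring
  simp_rw [hsplit, Finset.sum_sub_distrib, Finset.sum_ite_eq' (Finset.Icc 1 M) 1, if_pos h1S,
    ← Finset.mul_sum]
  simp [mul_comm]

/-! ## §3 — The one-term law -/

/-- **THE ONE-TERM LAW (value of the constant mollifier `a = H_M/(2M − H_M)`).** For `M ≥ 1`,
`∫⁻ ofReal(‖1 − ζ_M(1/2+it)·a‖²/(1/4+t²)) = ofReal(2π(1 − H_M²/(2M − H_M)))`.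
[cite: BaezDuarte2003, Theorem 1.1 (the distance `d_N` in Dirichlet-polynomial form)] -/
theorem lintegral_one_sub_const_mul_zetaPartialSum {M : ℕ} (hM : 1 ≤ M) :
    ∫⁻ t : ℝ, ENNReal.ofReal (‖1 - zetaPartialSum M (1 / 2 + t * Complex.I) *
        ∑ n : Fin 1, (fun _ : Fin 1 ↦ (((∑ n ∈ Finset.Icc 1 M, (1 : ℝ) / n) /
          (2 * M - ∑ n ∈ Finset.Icc 1 M, (1 : ℝ) / n) : ℝ) : ℂ)) n *
            ((n : ℂ) + 1) ^ (-(1 / 2 + t * Complex.I))‖ ^ 2 / (1 / 4 + t ^ 2)) =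
      ENNReal.ofReal (2 * Real.pi * (1 - (∑ n ∈ Finset.Icc 1 M, (1 : ℝ) / n) ^ 2 /
        (2 * M - ∑ n ∈ Finset.Icc 1 M, (1 : ℝ) / n))) := by
  set H : ℝ := ∑ n ∈ Finset.Icc 1 M, (1 : ℝ) / n with hH
  set a : ℝ := H / (2 * M - H) with ha
  set c : ℕ → ℂ := fun m ↦ ((((if m = 1 then (1 : ℝ) else 0) - a : ℝ) : ℂ)) with hc
  have hS : ∀ m ∈ Finset.Icc 1 M, m ≠ 0 := by
    intro m hm; rw [Finset.mem_Icc] at hm; omega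
  -- `H ≤ M`, so the denominator `2M − H` is positive
  have hHM : H ≤ M := by
    rw [hH]
    calc ∑ n ∈ Finset.Icc 1 M, (1 : ℝ) / n ≤ ∑ n ∈ Finset.Icc 1 M, (1 : ℝ) := by
          refine Finset.sum_le_sum fun n hn ↦ ?_
          rw [Finset.mem_Icc] at hn
          rw [div_le_one (by exact_mod_cast (by omega : 0 < n))]
          exact_mod_cast hn.1
      _ = M := by simp
  have hM1 : (1 : ℝ) ≤ M := by exact_mod_cast hM
  have hD : 0 < 2 * (M : ℝ) - H := by linarith
  -- rewrite the integrand as a Gram integrand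
  have hint : ∀ t : ℝ, ‖1 - zetaPartialSum M (1 / 2 + t * Complex.I) *
      ∑ n : Fin 1, (fun _ : Fin 1 ↦ ((a : ℝ) : ℂ)) n * ((n : ℂ) + 1) ^ (-(1 / 2 + t * Complex.I))‖ ^ 2 /
        (1 / 4 + t ^ 2) =
      ‖∑ m ∈ Finset.Icc 1 M, c m * (m : ℂ) ^ (-(1 / 2 + t * I))‖ ^ 2 / (1 / 4 + t ^ 2) := by
    intro t
    rw [one_sub_zetaPartialSum_mul_const hM a]
  simp_rw [hint]
  -- lintegral = ofReal integral, then the Gram expansion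
  rw [← ofReal_integral_eq_lintegral_ofReal (integrable_norm_sq_sum_cpow_div _ hS c)
    (Filter.Eventually.of_forall fun t ↦ by positivity), integral_norm_sq_sum_cpow_div _ hS c]
  congr 1
  have hre : ∀ m n : ℕ, (c m * conj (c n)).re =
      ((if m = 1 then (1 : ℝ) else 0) - a) * ((if n = 1 then (1 : ℝ) else 0) - a) := by
    intro m n
    rw [hc]
    simp only [Complex.conj_ofReal, ← Complex.ofReal_mul, Complex.ofReal_re]
  simp_rw [hre]
  rw [gram_value_e_one_sub_const hM a, ← hH, ha]
  field_simp
  ring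

/-- **Closer of item stmt-RiemannHypothesis-22976** (route `NbGhostOfThePole`, crux r3), by name:
`TrivialGainLaw` — the exact one-term law `∫ |1 − a ζ_M|² dt/(1/4+t²) = 2π(1 − H_M²/(2M − H_M))`
at `a = H_M/(2M − H_M)` for every `M ≥ 1` (`lintegral_one_sub_const_mul_zetaPartialSum`).
RH-free; no summit is proved by this; nothing here bears on the truth of RH.
[cite: BaezDuarte2003, Theorem 1.1] -/
theorem TrivialGainLaw_proof :
    Summit.RiemannHypothesis.RiemannHypothesis.Theses.NbGhostOfThePole.TrivialGainLaw := by
  intro M hM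
  exact ⟨_, lintegral_one_sub_const_mul_zetaPartialSum hM⟩

end Summit.RiemannHypothesis.RiemannHypothesis.Theorems.NbGhostOfThePole

end
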